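import Literature.Probability.Process.ConformalKilledPath
import HarnessLib

/-!
# Conformal invariance of planar Brownian motion killed on leaving a domain (exhaustion)

Ninth file on P. Lévy's conformal invariance of planar Brownian motion (Lawler (2005), Thm. 2.2,
§2.4, Prop. 5.5). `ConformalKilledPath.lintegral_killed_conformal_eq` gives the functional
identity for the motion killed on leaving a *relatively compact* open `U_ℂ ⊆ D`; here we exhaust
the open set `D` by such sets and pass to the limit by monotone convergence, obtaining the
identity for the motion killed on leaving `D` itself (`f` holomorphic, injective and open on `D`,
`f' ≠ 0`):

* `exists_exhaustion` — an increasing sequence of bounded open sets with closures in `D`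
  swallowing every compact subset of `D`;
* `measurable_imageOn_toContinuousMap` — `γ ↦ f ∘ γ` (`Curve.imageOn` on `C([0,1], ℂ)`) is Borel
  measurable for `D` open; `measurable_intervalIntegral_prod` — a parametric interval integral
  of a jointly measurable integrand is measurable;
* `iSup_indicator_staysIn` — `𝟙{p([0,u]) ⊆ ⋃ Vₙ} = supₙ 𝟙{p([0,u]) ⊆ Vₙ}` for an increasing open
  cover, and the resulting monotone-convergence identity `lintegral_staysIn_iUnion`;
* `lintegral_killed_conformal_eq_of_isOpen` — **the identity with `D`, `f(D)` in place of
  `U_ℂ`, `f(U_ℂ)`**: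
  `E[∫₀^{τ_D} Ψ([f ∘ X|[0,t]], ∫₀ᵗ|f'(X)|²) |f'(X_t)|² dt] = E'[∫₀^{τ_{f(D)}} Ψ([B'|[0,u]], u) du]`.

## References

* G. F. Lawler, *Conformally Invariant Processes in the Plane*, AMS (2005), Thm. 2.2, §2.4,
  Prop. 5.5.
-/

noncomputable section

open MeasureTheory ProbabilityTheory Filter Topology Set Complex Metric
open scoped NNReal ENNReal BigOperators ComplexConjugate unitInterval

namespace Literature.Probability.Process

open Literature.Probability.RandomPlanarGeometry

variable {Ω Ω' : Type*} {mΩ : MeasurableSpace Ω} {mΩ' : MeasurableSpace Ω'} {P : Measure Ω}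
  {P' : Measure Ω'} {W : ℝ≥0 → Ω → (Fin 2 → ℝ)} {W' : ℝ≥0 → Ω' → (Fin 2 → ℝ)}

/-! ### Exhaustion of an open set by relatively compact open sets -/

/-- **Exhaustion of an open `D ⊆ ℂ`**: bounded open sets `U₀ ⊆ U₁ ⊆ ⋯` with `closure Uₙ ⊆ D`
such that every compact subset of `D` lies in some `Uₙ`
(`Uₙ = B(0, n+1) ∩ interior {z | B̄(z, 1/(n+1)) ⊆ D}`). [folklore] -/
theorem exists_exhaustion {D : Set ℂ} (hD : IsOpen D) :
    ∃ U : ℕ → Set ℂ, (∀ n, IsOpen (U n)) ∧ (∀ n, Bornology.IsBounded (U n)) ∧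
      (∀ n, closure (U n) ⊆ D) ∧ Monotone U ∧ ∀ K, IsCompact K → K ⊆ D → ∃ n, K ⊆ U n := by
  set A : ℕ → Set ℂ := fun n ↦ {z | closedBall z (1 / ((n : ℝ) + 1)) ⊆ D} with hA
  set U : ℕ → Set ℂ := fun n ↦ ball 0 ((n : ℝ) + 1) ∩ interior (A n) with hU
  have hle : ∀ {m n : ℕ}, m ≤ n → (m : ℝ) + 1 ≤ (n : ℝ) + 1 := fun hmn ↦ by
    exact_mod_cast Nat.succ_le_succ hmn
  have hAmono : Monotone A := fun m n hmn z hz ↦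
    (closedBall_subset_closedBall (one_div_le_one_div_of_le (by positivity) (hle hmn))).trans hz
  refine ⟨U, fun n ↦ isOpen_ball.inter isOpen_interior, fun n ↦ isBounded_ball.subset inter_subset_left,
    fun n ↦ ?_, fun m n hmn ↦ inter_subset_inter (ball_subset_ball (hle hmn)) (interior_mono (hAmono hmn)),
    fun K hK hKD ↦ ?_⟩
  · -- closure in `D`: a limit of centres of balls of radius `r` in `D` is in `D`
    intro z hz
    have hz' : z ∈ closure (A n) := closure_mono (inter_subset_right.trans interior_subset) hz
    rw [Metric.mem_closure_iff] at hz'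
    obtain ⟨w, hw, hzw⟩ := hz' (1 / ((n : ℝ) + 1)) (by positivity)
    exact hw (mem_closedBall.2 hzw.le)
  · -- a compact subset of `D` is swallowed
    obtain ⟨δ, hδ, hthick⟩ := hK.exists_cthickening_subset_open hD hKD
    obtain ⟨R, hR⟩ := hK.isBounded.subset_ball 0
    obtain ⟨n, hn⟩ := exists_nat_gt (max R (2 / δ))
    have hnR : R ≤ (n : ℝ) + 1 := by linarith [le_max_left R (2 / δ)]
    have hnδ : 1 / ((n : ℝ) + 1) ≤ δ / 2 := by
      have h2 : 2 / δ < (n : ℝ) + 1 := by linarith [le_max_right R (2 / δ)]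
      rw [div_lt_iff₀ hδ] at h2
      rw [div_le_iff₀ (by positivity : (0 : ℝ) < n + 1)]
      linarith
    refine ⟨n, fun z hz ↦ ⟨ball_subset_ball hnR (hR hz), ?_⟩⟩
    -- `K ⊆ thickening (δ/2) K ⊆ A n`, an open set
    have hsub : thickening (δ / 2) K ⊆ A n := by
      intro w hw y hy
      refine hthick ?_
      rw [mem_thickening_iff] at hw
      obtain ⟨k, hk, hwk⟩ := hw
      refine mem_cthickening_of_dist_le y k δ K hk ?_
      calc dist y k ≤ dist y w + dist w k := dist_triangle _ _ _
        _ ≤ 1 / ((n : ℝ) + 1) + δ / 2 := add_le_add (mem_closedBall.1 hy) hwk.le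
        _ ≤ δ := by linarith
    exact interior_maximal hsub isOpen_thickening (self_subset_thickening (by positivity) K hz)

/-- The sets of an exhaustion cover `D`. [folklore] -/
theorem iUnion_eq_of_exhaustion {D : Set ℂ} {U : ℕ → Set ℂ} (hUD : ∀ n, closure (U n) ⊆ D)
    (hUK : ∀ K, IsCompact K → K ⊆ D → ∃ n, K ⊆ U n) : (⋃ n, U n) = D := by
  refine subset_antisymm (iUnion_subset fun n ↦ subset_closure.trans (hUD n)) fun z hz ↦ ?_
  obtain ⟨n, hn⟩ := hUK {z} isCompact_singleton (singleton_subset_iff.2 hz)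
  exact mem_iUnion.2 ⟨n, hn rfl⟩

/-! ### Measurability of `γ ↦ f ∘ γ` on `C([0,1], ℂ)` -/

section ImageOn

variable [MeasurableSpace C(I, ℂ)] [BorelSpace C(I, ℂ)]

/-- **`γ ↦ f ∘ γ` (`Curve.imageOn`, junk `γ` when `γ` leaves `D` or `f` is discontinuous) is Borel
measurable on `C([0,1], ℂ)`** for `D` open (all evaluations are measurable). [folklore] -/
theorem measurable_imageOn_toContinuousMap {D : Set ℂ} (hD : IsOpen D) (f : ℂ → ℂ) :
    Measurable fun γ : C(I, ℂ) ↦ ((Curve.mk γ).imageOn f D).toContinuousMap := by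
  classical
  by_cases hf : ContinuousOn f D
  · have h := measurable_continuousMap_of_eval
      (Φ := fun γ : C(I, ℂ) ↦ ((Curve.mk γ).imageOn f D).toContinuousMap) fun r ↦ ?_
    · rwa [← BorelSpace.measurable_eq] at h
    set S : Set C(I, ℂ) := {γ | range γ ⊆ D} with hS
    have heq : (fun γ : C(I, ℂ) ↦ ((Curve.mk γ).imageOn f D).toContinuousMap r) = fun γ : C(I, ℂ) ↦
        if h : γ ∈ S then D.restrict f ⟨γ r, h ⟨r, rfl⟩⟩ else γ r := by
      funext γ
      by_cases h : γ ∈ S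
      · rw [dif_pos h]
        exact Curve.imageOn_apply hf (γ := Curve.mk γ) h r
      · rw [dif_neg h, Curve.imageOn_of_not_subset (γ := Curve.mk γ) h]
    rw [heq]
    have hc : Continuous fun γ : S ↦ (⟨(γ : C(I, ℂ)) r, γ.2 ⟨r, rfl⟩⟩ : D) :=
      ((continuous_eval_const r).comp continuous_subtype_val).subtype_mk _
    have h1 : Measurable fun γ : S ↦ D.restrict f ⟨(γ : C(I, ℂ)) r, γ.2 ⟨r, rfl⟩⟩ :=
      (hf.restrict.comp hc).measurable
    have h2 : Measurable fun γ : (Sᶜ : Set C(I, ℂ)) ↦ (γ : C(I, ℂ)) r :=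
      (continuous_eval_const r).measurable.comp measurable_subtype_coe
    exact Measurable.dite h1 h2 (ContinuousMap.isOpen_setOf_range_subset hD).measurableSet
  · have : (fun γ : C(I, ℂ) ↦ ((Curve.mk γ).imageOn f D).toContinuousMap) = id :=
      funext fun γ ↦ by rw [Curve.imageOn_of_not (γ := Curve.mk γ) fun h ↦ hf h.1]; rfl
    rw [this]
    exact measurable_id

end ImageOn

/-- **The class of the image of the segment `p|[0,u]` is jointly Borel measurable in `(p, u)`.**
[folklore] -/
theorem measurable_curveClass_imageOn_pathSeg [MeasurableSpace C(ℝ≥0, ℂ)] [BorelSpace C(ℝ≥0, ℂ)]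
    {D : Set ℂ} (hD : IsOpen D) (f : ℂ → ℂ) :
    Measurable fun x : C(ℝ≥0, ℂ) × ℝ≥0 ↦ CurveClass.mk ((Curve.mk (pathSeg x.1 x.2)).imageOn f D) := by
  letI : MeasurableSpace C(I, ℂ) := borel _
  haveI : BorelSpace C(I, ℂ) := ⟨rfl⟩
  have h1 : Measurable fun x : C(ℝ≥0, ℂ) × ℝ≥0 ↦ pathSeg x.1 x.2 := continuous_pathSeg.measurable
  have h2 := measurable_imageOn_toContinuousMap hD f
  have h3 : Continuous fun γ : C(I, ℂ) ↦ CurveClass.mk (Curve.mk γ) := continuous_curveClass_mk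
  exact h3.measurable.comp (h2.comp h1)

/-! ### Parametric interval integrals -/

/-- **A parametric interval integral `x ↦ ∫₀^{x.2} g(x.1, r) dr` of a jointly measurable real
integrand is measurable.** [folklore] -/
theorem measurable_intervalIntegral_prod {α : Type*} [MeasurableSpace α] {g : α × ℝ → ℝ}
    (hg : Measurable g) : Measurable fun x : α × ℝ ↦ ∫ r in (0 : ℝ)..x.2, g (x.1, r) := by
  -- `∫ over {r | (x, r) ∈ T}` is measurable in `x` for `T` measurable with measurable sections
  have key : ∀ T : Set ((α × ℝ) × ℝ), MeasurableSet T → (∀ x, MeasurableSet {r | (x, r) ∈ T}) →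
      Measurable fun x : α × ℝ ↦ ∫ r in {r | (x, r) ∈ T}, g (x.1, r) := by
    intro T hT hTx
    have hg' : Measurable fun p : (α × ℝ) × ℝ ↦ g (p.1.1, p.2) :=
      hg.comp ((measurable_fst.comp measurable_fst).prodMk measurable_snd)
    have hF : StronglyMeasurable (T.indicator fun p : (α × ℝ) × ℝ ↦ g (p.1.1, p.2)) :=
      (hg'.indicator hT).stronglyMeasurable
    have h := hF.integral_prod_right' (ν := volume)
    have e : (fun x : α × ℝ ↦ ∫ r in {r | (x, r) ∈ T}, g (x.1, r)) =
        fun x ↦ ∫ r, T.indicator (fun p : (α × ℝ) × ℝ ↦ g (p.1.1, p.2)) (x, r) := by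
      funext x
      rw [← integral_indicator (hTx x)]
      rfl
    rw [e]
    exact h.measurable
  have hT1 : MeasurableSet {p : (α × ℝ) × ℝ | 0 < p.2 ∧ p.2 ≤ p.1.2} :=
    (measurableSet_lt measurable_const measurable_snd).inter
      (measurableSet_le measurable_snd (measurable_snd.comp measurable_fst))
  have hT2 : MeasurableSet {p : (α × ℝ) × ℝ | p.1.2 < p.2 ∧ p.2 ≤ 0} :=
    (measurableSet_lt (measurable_snd.comp measurable_fst) measurable_snd).inter
      (measurableSet_le measurable_snd measurable_const)
  have h1 := key _ hT1 fun x ↦ measurableSet_Ioc (a := 0) (b := x.2)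
  have h2 := key _ hT2 fun x ↦ measurableSet_Ioc (a := x.2) (b := 0)
  exact h1.sub h2

/-! ### Monotone convergence along an increasing open cover -/

section Cover

variable [MeasurableSpace C(ℝ≥0, ℂ)] [BorelSpace C(ℝ≥0, ℂ)]

omit [MeasurableSpace C(ℝ≥0, ℂ)] [BorelSpace C(ℝ≥0, ℂ)] in
/-- **`𝟙{p([0,u]) ⊆ ⋃ Vₙ} = supₙ 𝟙{p([0,u]) ⊆ Vₙ}`** for an increasing sequence of open sets
(`p([0,u])` is compact). [folklore] -/
theorem iSup_indicator_staysIn {V : ℕ → Set ℂ} (hVo : ∀ n, IsOpen (V n)) (hmono : Monotone V)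
    (x : C(ℝ≥0, ℂ) × ℝ≥0) :
    ⨆ n, (staysIn (V n)).indicator (1 : C(ℝ≥0, ℂ) × ℝ≥0 → ℝ≥0∞) x = (staysIn (⋃ n, V n)).indicator 1 x := by
  refine le_antisymm (iSup_le fun n ↦ indicator_le_indicator_of_subset
    (staysIn_mono (subset_iUnion V n)) (fun _ ↦ zero_le) x) ?_
  by_cases hx : x ∈ staysIn (⋃ n, V n)
  · -- the compact set `p([0,u])` lies in some `Vₙ`
    have hK : IsCompact (x.1 '' Icc 0 x.2) := isCompact_Icc.image x.1.continuous
    have hKsub : x.1 '' Icc 0 x.2 ⊆ ⋃ n, V n := mapsTo_iff_image_subset.1 hx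
    obtain ⟨n, hn⟩ := hK.elim_directed_cover V hVo hKsub hmono.directed_le
    have hxn : x ∈ staysIn (V n) := mapsTo_iff_image_subset.2 hn
    rw [indicator_of_mem hx]
    calc (1 : C(ℝ≥0, ℂ) × ℝ≥0 → ℝ≥0∞) x = (staysIn (V n)).indicator 1 x := (indicator_of_mem hxn _).symm
      _ ≤ ⨆ n, (staysIn (V n)).indicator (1 : C(ℝ≥0, ℂ) × ℝ≥0 → ℝ≥0∞) x :=
        le_iSup (fun n ↦ (staysIn (V n)).indicator (1 : C(ℝ≥0, ℂ) × ℝ≥0 → ℝ≥0∞) x) n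
  · rw [indicator_of_notMem hx]
    exact zero_le

/-- **Monotone convergence along an increasing open cover**: for `X : Ω → C(ℝ≥0, ℂ)` measurable
and `g ≥ 0` jointly measurable,
`E[∫₀^∞ 𝟙{X([0,t]) ⊆ ⋃ Vₙ} g(t) dt] = supₙ E[∫₀^∞ 𝟙{X([0,t]) ⊆ Vₙ} g(t) dt]`. [folklore] -/
theorem lintegral_staysIn_iUnion {P : Measure Ω} {X : Ω → C(ℝ≥0, ℂ)} (hX : Measurable X)
    {V : ℕ → Set ℂ} (hVo : ∀ n, IsOpen (V n)) (hmono : Monotone V) {g : Ω → ℝ → ℝ≥0∞}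
    (hg : Measurable fun x : Ω × ℝ ↦ g x.1 x.2) :
    ∫⁻ ω, (∫⁻ t in Ioi (0 : ℝ), (staysIn (⋃ n, V n)).indicator 1 (X ω, t.toNNReal) * g ω t) ∂P =
      ⨆ n, ∫⁻ ω, (∫⁻ t in Ioi (0 : ℝ), (staysIn (V n)).indicator 1 (X ω, t.toNNReal) * g ω t) ∂P := by
  have hmeas : ∀ n, Measurable fun x : Ω × ℝ ↦ (staysIn (V n)).indicator 1 (X x.1, x.2.toNNReal) * g x.1 x.2 :=
    fun n ↦ ((measurable_one.indicator (measurableSet_staysIn (hVo n))).comp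
        ((hX.comp measurable_fst).prodMk (measurable_real_toNNReal.comp measurable_snd))).mul hg
  have hmono' : ∀ (ω : Ω) (t : ℝ), Monotone fun n ↦ (staysIn (V n)).indicator
      (1 : C(ℝ≥0, ℂ) × ℝ≥0 → ℝ≥0∞) (X ω, t.toNNReal) * g ω t :=
    fun ω t m n hmn ↦ mul_le_mul' (indicator_le_indicator_of_subset
      (staysIn_mono (hmono hmn)) (fun _ ↦ zero_le) _) le_rfl
  -- pointwise supremum
  have hpt : ∀ (ω : Ω) (t : ℝ), (staysIn (⋃ n, V n)).indicator 1 (X ω, t.toNNReal) * g ω t =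
      ⨆ n, (staysIn (V n)).indicator (1 : C(ℝ≥0, ℂ) × ℝ≥0 → ℝ≥0∞) (X ω, t.toNNReal) * g ω t := by
    intro ω t
    rw [← ENNReal.iSup_mul, iSup_indicator_staysIn hVo hmono]
  simp_rw [hpt]
  -- inner monotone convergence
  have hinner : ∀ ω, ∫⁻ t in Ioi (0 : ℝ), ⨆ n, (staysIn (V n)).indicator
      (1 : C(ℝ≥0, ℂ) × ℝ≥0 → ℝ≥0∞) (X ω, t.toNNReal) * g ω t =
      ⨆ n, ∫⁻ t in Ioi (0 : ℝ), (staysIn (V n)).indicator (1 : C(ℝ≥0, ℂ) × ℝ≥0 → ℝ≥0∞) (X ω, t.toNNReal) * g ω t :=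
    fun ω ↦ lintegral_iSup (fun n ↦ (hmeas n).comp measurable_prodMk_left) (fun m n hmn t ↦ hmono' ω t hmn)
  simp_rw [hinner]
  -- outer monotone convergence
  refine lintegral_iSup (fun n ↦ (hmeas n).lintegral_prod_right') fun m n hmn ω ↦ ?_
  exact lintegral_mono fun t ↦ hmono' ω t hmn

end Cover

/-! ### The main identity on `D` -/

namespace IsBrownianVec

variable {x₀ : Fin 2 → ℝ} {D : Set ℂ} {f : ℂ → ℂ}

section Main

variable [IsProbabilityMeasure P] [IsProbabilityMeasure P'] [MeasurableSpace C(ℝ≥0, ℂ)] [BorelSpace C(ℝ≥0, ℂ)]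

omit [IsProbabilityMeasure P] in
/-- The path `t ↦ x₀ + W_t`, read in `ℂ`, is a measurable `C(ℝ≥0, ℂ)`-valued map. [folklore] -/
theorem measurable_mkD_path (hW : IsBrownianVec W P) (x₀ : Fin 2 → ℝ) :
    Measurable fun ω ↦ ContinuousMap.mkD (fun t ↦ toC (x₀ + W t ω)) 0 := by
  have hc : ∀ ω, Continuous fun t ↦ toC (x₀ + W t ω) :=
    fun ω ↦ continuous_toC.comp (continuous_const.add (hW.continuous_path ω))
  have e : (fun ω ↦ ContinuousMap.mkD (fun t ↦ toC (x₀ + W t ω)) 0) =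
      fun ω ↦ (⟨fun t ↦ toC (x₀ + W t ω), hc ω⟩ : C(ℝ≥0, ℂ)) :=
    funext fun ω ↦ ContinuousMap.mkD_of_continuous (hc ω)
  rw [e]
  have := measurable_continuousMap_of_eval (Φ := fun ω ↦ (⟨fun t ↦ toC (x₀ + W t ω), hc ω⟩ : C(ℝ≥0, ℂ)))
    fun a ↦ measurable_toC.comp (measurable_const.add (hW.measurable a))
  rwa [← BorelSpace.measurable_eq] at this

omit [IsProbabilityMeasure P] [MeasurableSpace C(ℝ≥0, ℂ)] [BorelSpace C(ℝ≥0, ℂ)] in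
/-- Joint measurability of `(ω, r) ↦ |f'(X_r)|²` (real time). [folklore] -/
theorem measurable_derivSq_path (hW : IsBrownianVec W P) (x₀ : Fin 2 → ℝ) (f : ℂ → ℂ) :
    Measurable fun x : Ω × ℝ ↦ ‖deriv f (toC (x₀ + W x.2.toNNReal x.1))‖ ^ 2 := by
  have hunc : Measurable (Function.uncurry W) :=
    measurable_uncurry_of_continuous_of_measurable hW.continuous_path hW.measurable
  have h1 : Measurable fun x : Ω × ℝ ↦ W x.2.toNNReal x.1 :=
    hunc.comp ((measurable_real_toNNReal.comp measurable_snd).prodMk measurable_fst)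
  exact ((measurable_deriv f).comp (measurable_toC.comp (measurable_const.add h1))).norm.pow_const 2

omit [IsProbabilityMeasure P] in
/-- Joint measurability of the left-hand integrand
`(ω, t) ↦ Ψ([f ∘ X|[0,t]], ∫₀ᵗ|f'(X)|²) |f'(X_t)|²`. [folklore] -/
theorem measurable_lhsIntegrand (hW : IsBrownianVec W P) (hD : IsOpen D) (x₀ : Fin 2 → ℝ) (f : ℂ → ℂ)
    {Ψ : CurveClass ℂ × ℝ → ℝ≥0∞} (hΨ : Measurable Ψ) :
    Measurable fun x : Ω × ℝ ↦
      Ψ (CurveClass.mk ((Curve.mk (pathSeg (ContinuousMap.mkD (fun t ↦ toC (x₀ + W t x.1)) 0) x.2.toNNReal)).imageOn f D),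
          ∫ r in (0 : ℝ)..x.2, ‖deriv f (toC (x₀ + W r.toNNReal x.1))‖ ^ 2) *
        ENNReal.ofReal (‖deriv f (toC (x₀ + W x.2.toNNReal x.1))‖ ^ 2) := by
  have hX := hW.measurable_mkD_path x₀
  have h1 : Measurable fun x : Ω × ℝ ↦ CurveClass.mk
      ((Curve.mk (pathSeg (ContinuousMap.mkD (fun t ↦ toC (x₀ + W t x.1)) 0) x.2.toNNReal)).imageOn f D) :=
    (measurable_curveClass_imageOn_pathSeg hD f).comp
      ((hX.comp measurable_fst).prodMk (measurable_real_toNNReal.comp measurable_snd))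
  have h2 : Measurable fun x : Ω × ℝ ↦ ∫ r in (0 : ℝ)..x.2, ‖deriv f (toC (x₀ + W r.toNNReal x.1))‖ ^ 2 :=
    measurable_intervalIntegral_prod (g := fun x : Ω × ℝ ↦ ‖deriv f (toC (x₀ + W x.2.toNNReal x.1))‖ ^ 2)
      (hW.measurable_derivSq_path x₀ f)
  have h3 := hW.measurable_derivSq_path x₀ f
  exact (hΨ.comp (h1.prodMk h2)).mul h3.ennreal_ofReal

omit [IsProbabilityMeasure P'] in
/-- The path `u ↦ y₀ + W'_u`, read in `ℂ`, is a measurable `C(ℝ≥0, ℂ)`-valued map. [folklore] -/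
theorem measurable_mkD_refPath (hW' : IsBrownianVec W' P') (y₀ : ℂ) :
    Measurable fun ω' ↦ ContinuousMap.mkD (fun u ↦ y₀ + toC (W' u ω')) 0 := by
  have hc : ∀ ω', Continuous fun u ↦ y₀ + toC (W' u ω') :=
    fun ω' ↦ continuous_const.add (continuous_toC.comp (hW'.continuous_path ω'))
  have e : (fun ω' ↦ ContinuousMap.mkD (fun u ↦ y₀ + toC (W' u ω')) 0) =
      fun ω' ↦ (⟨fun u ↦ y₀ + toC (W' u ω'), hc ω'⟩ : C(ℝ≥0, ℂ)) :=
    funext fun ω' ↦ ContinuousMap.mkD_of_continuous (hc ω')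
  rw [e]
  exact measurable_refPath hW' y₀

omit [IsProbabilityMeasure P'] in
/-- Joint measurability of the right-hand integrand `(ω', u) ↦ Ψ([B'|[0,u]], u)`. [folklore] -/
theorem measurable_rhsIntegrand (hW' : IsBrownianVec W' P') (y₀ : ℂ) {Ψ : CurveClass ℂ × ℝ → ℝ≥0∞}
    (hΨ : Measurable Ψ) :
    Measurable fun x : Ω' × ℝ ↦
      Ψ (CurveClass.mk (Curve.mk (pathSeg (ContinuousMap.mkD (fun u ↦ y₀ + toC (W' u x.1)) 0) x.2.toNNReal)), x.2) := by
  have hB := hW'.measurable_mkD_refPath y₀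
  have h2 : Measurable fun x : C(ℝ≥0, ℂ) × ℝ≥0 ↦ CurveClass.mk (Curve.mk (pathSeg x.1 x.2)) :=
    (continuous_curveClass_mk.comp continuous_pathSeg).measurable
  exact hΨ.comp ((h2.comp ((hB.comp measurable_fst).prodMk (measurable_real_toNNReal.comp measurable_snd))).prodMk
    measurable_snd)

/-- **Conformal invariance of planar Brownian motion killed on leaving a domain, functional form**
([Lawler] Thm. 2.2 with §2.4 / Prop. 5.5): for `D` open, `f` holomorphic, injective and open on
`D` with `f' ≠ 0`, `x₀ ∈ D`, and `Ψ ≥ 0` measurable on (curve class, time),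

  `E[∫₀^{τ_D} Ψ([f ∘ X|[0,t]], ∫₀ᵗ|f'(X)|²) |f'(X_t)|² dt] = E'[∫₀^{τ_{f(D)}} Ψ([B'|[0,u]], u) du]`,

`X = x₀ + W` killed on leaving `D`, `B' = f(x₀) + W'` killed on leaving `f(D)` (exhaustion of `D`
by relatively compact open sets and monotone convergence from
`lintegral_killed_conformal_eq`). [cite: Lawler2005ConformallyInvariant, Thm. 2.2] -/
theorem lintegral_killed_conformal_eq_of_isOpen (hW : IsBrownianVec W P) (hW' : IsBrownianVec W' P')
    (hD : IsOpen D) (hf : DifferentiableOn ℂ f D) (hf' : ∀ z ∈ D, deriv f z ≠ 0) (hfi : InjOn f D)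
    (hfo : ∀ V, IsOpen V → V ⊆ D → IsOpen (f '' V)) (hx₀ : toC x₀ ∈ D)
    {Ψ : CurveClass ℂ × ℝ → ℝ≥0∞} (hΨ : Measurable Ψ) :
    ∫⁻ ω, (∫⁻ t in Ioi (0 : ℝ),
        (staysIn D).indicator 1 (ContinuousMap.mkD (fun t ↦ toC (x₀ + W t ω)) 0, t.toNNReal) *
          Ψ (CurveClass.mk ((Curve.mk (pathSeg (ContinuousMap.mkD (fun t ↦ toC (x₀ + W t ω)) 0) t.toNNReal)).imageOn f D),
              ∫ r in (0 : ℝ)..t, ‖deriv f (toC (x₀ + W r.toNNReal ω))‖ ^ 2) *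
          ENNReal.ofReal (‖deriv f (toC (x₀ + W t.toNNReal ω))‖ ^ 2)) ∂P =
      ∫⁻ ω', (∫⁻ u in Ioi (0 : ℝ),
        (staysIn (f '' D)).indicator 1 (ContinuousMap.mkD (fun u ↦ f (toC x₀) + toC (W' u ω')) 0, u.toNNReal) *
          Ψ (CurveClass.mk (Curve.mk (pathSeg (ContinuousMap.mkD (fun u ↦ f (toC x₀) + toC (W' u ω')) 0) u.toNNReal)), u))
        ∂P' := by
  obtain ⟨U, hUo, hUb, hUD, hUmono, hUK⟩ := exists_exhaustion hD
  have hUnion : (⋃ n, U n) = D := iUnion_eq_of_exhaustion hUD hUK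
  have hUnion' : (⋃ n, f '' U n) = f '' D := by rw [← image_iUnion, hUnion]
  obtain ⟨n₀, hn₀⟩ := hUK {toC x₀} isCompact_singleton (singleton_subset_iff.2 hx₀)
  have hx₀n : ∀ n, toC x₀ ∈ U (n + n₀) := fun n ↦ hUmono (Nat.le_add_left n₀ n) (hn₀ rfl)
  have hfUo : ∀ n, IsOpen (f '' U n) := fun n ↦ hfo _ (hUo n) (subset_closure.trans (hUD n))
  have hfUmono : Monotone fun n ↦ f '' U n := fun m n hmn ↦ image_mono (hUmono hmn)
  -- measurable ingredients
  have hX := hW.measurable_mkD_path x₀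
  have hg := hW.measurable_lhsIntegrand hD x₀ f hΨ
  have hB := hW'.measurable_mkD_refPath (f (toC x₀))
  have hg' := hW'.measurable_rhsIntegrand (f (toC x₀)) hΨ
  -- monotone convergence on both sides
  have e1 : staysIn D = staysIn (⋃ n, U n) := by rw [hUnion]
  have e2 : staysIn (f '' D) = staysIn (⋃ n, f '' U n) := by rw [hUnion']
  simp only [e1, e2, mul_assoc]
  rw [lintegral_staysIn_iUnion (g := fun ω t ↦
      Ψ (CurveClass.mk ((Curve.mk (pathSeg (ContinuousMap.mkD (fun t ↦ toC (x₀ + W t ω)) 0) t.toNNReal)).imageOn f D),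
          ∫ r in (0 : ℝ)..t, ‖deriv f (toC (x₀ + W r.toNNReal ω))‖ ^ 2) *
        ENNReal.ofReal (‖deriv f (toC (x₀ + W t.toNNReal ω))‖ ^ 2)) hX hUo hUmono hg,
    lintegral_staysIn_iUnion (g := fun ω' u ↦
      Ψ (CurveClass.mk (Curve.mk (pathSeg (ContinuousMap.mkD (fun u ↦ f (toC x₀) + toC (W' u ω')) 0) u.toNNReal)), u))
      hB hfUo hfUmono hg']
  -- eventual agreement of two monotone sequences
  have key : ∀ L R : ℕ → ℝ≥0∞, Monotone L → Monotone R → (∀ n, L (n + n₀) = R (n + n₀)) →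
      ⨆ n, L n = ⨆ n, R n := by
    intro L R hL hR h
    rw [← hL.iSup_nat_add n₀, ← hR.iSup_nat_add n₀]
    exact iSup_congr h
  refine key _ _ (fun m n hmn ↦ ?_) (fun m n hmn ↦ ?_) fun n ↦ ?_
  · exact lintegral_mono fun ω ↦ lintegral_mono fun t ↦ mul_le_mul'
      (indicator_le_indicator_of_subset (staysIn_mono (hUmono hmn)) (fun _ ↦ zero_le) _) le_rfl
  · exact lintegral_mono fun ω' ↦ lintegral_mono fun u ↦ mul_le_mul'
      (indicator_le_indicator_of_subset (staysIn_mono (hfUmono hmn)) (fun _ ↦ zero_le) _) le_rfl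
  · have h := hW.lintegral_killed_conformal_eq hW' hD hf hf' hfi (hUo (n + n₀)) (hUb (n + n₀)) (hUD (n + n₀))
      (hfUo (n + n₀)) (hx₀n n) hΨ
    simp only [mul_assoc] at h
    exact h

end Main

end IsBrownianVec

end Literature.Probability.Process

end
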